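import Summits.Ventures.QEC.Census.CertCoverBatch
import Summits.Ventures.QEC.Census.BB.A1s_n192_k4_0fa3ae82.CoreDefs
import HarnessLib

set_option Elab.async false
set_option maxRecDepth 200000

/-!
# `[[192,4,18]]` one-level cover certificate — LEVEL-1→0 coset problems 361…370 (problem 1 excluded: `Prob1.lean`) as COMPACT data
(`ProbData`: U, f, σ, y₀, allow; qec-type-10 `CertCoverBatch.mkCoset` rebuilds each `CosetProb` in the kernel) + their verdict
`probsOK cov covR hx hx1 D1 lxd 16` (one `decide +kernel`). qec-search-9 g5 (lead block 170 (0)(c)); data from JSON `level10.problems`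
(sha256 08367568…). Data + decided check; KERNEL.
-/

namespace Summit.Ventures.QEC.Census.A1s_n192_k4_0fa3ae82

open Matrix Summit.Ventures.QEC.Census Literature.InformationTheory.QuantumCodes

/-- Problems 361…370 (10): `⟨U, f, σ, y₀, allow⟩`. -/
def probs07b : List ProbData := [
    ⟨1818113991720146902237440, 0, 0, 0, [0]⟩,
    ⟨1818114563677230858273024, 2, 0, 0, [0]⟩,
    ⟨1818114672045101186811136, 0, 0, 0, [0]⟩,
    ⟨1818114997148677812949248, 0, 0, 0, [0]⟩,
    ⟨1818115716738788983202370, 0, 211106236858368, 1213648195112406534841414, []⟩,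
    ⟨1818115730179767261999265, 0, 105553118429184, 4611756387171565568, [0]⟩,
    ⟨1818116887534913461518592, 0, 0, 0, [0]⟩,
    ⟨1818118031449081373589760, 2, 0, 0, [0]⟩,
    ⟨1818118248184822030665984, 0, 0, 0, [0]⟩,
    ⟨1818118464920528328265984, 0, 0, 0, [0]⟩]

set_option maxHeartbeats 400000000 in
/-- Every problem of this chunk passes (`mkCoset` elimination + `cosetOKD` + fast `σ` + depth + `BU`-evenness + label checks). -/
theorem probs07b_ok : probsOK cov covR hx hx1 D1 lxd 16 probs07b = true := by
  decide +kernel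

/-- Pointwise form. -/
theorem probs07b_all : ∀ x ∈ probs07b, probOK cov covR hx hx1 D1 lxd 16 x = true := by
  have h := probs07b_ok
  rwa [probsOK, List.all_eq_true] at h

end Summit.Ventures.QEC.Census.A1s_n192_k4_0fa3ae82
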